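import Mathlib
import HarnessLib
import HarnessLib.Audit
import Summits.PneNP.PneNP.Theses.RamseyUncertifiable
import Summits.PneNP.PneNP.Theorems.RegularResolutionRung.Negative.EmptyGraphLines
import Literature.Computability.MetaComplexity.Resolution
import Literature.Computability.Complexity.Circuit
import Literature.Computability.Complexity.NegationElimination

/-!
# Line `jukna-game-monotone-interpolation` — crux `stmt-PneNP-9816`
(`Summit.PneNP.PneNP.Theses.RamseyUncertifiable.ResolutionUncertainty`)

LEAD SKELETON (prover-line-stmt-PneNP-9816-1, lead gen 1, 2026-08-16), reshaped from the crux-plan's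
CHECKED SKELETON (crux-plan, round 1): stub 1 is split into two REGISTERED stubs stated inline over tree
vocabulary — `stub_monotoneExtraction` (generic straight-line ∧/∨ extraction along a line DAG, pure
`Circuit`/`GateList` plumbing) and `stub_blockInvariant` (the two-sided Krajíček invariant:
extraction ⇒ `BlockInterpolation`) — so that two workers run in parallel and each helper file
`Theorems/RamseyUncertifiableResolutionUncertainty<Stub>.lean` can copy its statement byte-for-byte.
Idea card:
`Cruxes/ResolutionUncertainty/Ideas/jukna-game-monotone-interpolation.md`; line card:
`Cruxes/ResolutionUncertainty/Lines/jukna-game-monotone-interpolation.md`.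

The line is a STRUCTURE / RANDOMNESS split of the crux.

* `BlockInterpolation` (stub 1, provable now, Krajíček / Karchmer–Wigderson extraction for the
  BLOCK split of the unary clique formula): a resolution refutation `π` of `Clique(H, kA + kB)`
  yields a monotone circuit over the VERTEX variables, of size `≤ |π|`, accepting the indicator of
  every `kA`-clique and rejecting the *shadow* `A ∩ N(y)` of every `kB`-clique `y`.
* `ShadowLowerBound` (stub 2, the engine, research): on a RICH split — Alice region `A`, Bob
  region `B`, two-sided common-neighbourhood regularity up to level `(1-2η)·log₂ n`,
  `n^{c log₂ n}` spread `kA`-cliques of `A` extendable into `B` — every such monotone separator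
  has size `≥ n^{ε log₂ n}` (a size lower bound for Jukna's induced-clique function on a promise
  set; approximation method in the vertex model, with the catalogue-intersection obstruction
  recorded in the line card).
* `StructuredResidual` (stub 3, delegated): the crux's conclusion for the 2-Ramsey graphs NEITHER
  of whose sides `G`, `Gᶜ` has a rich split (a class disjoint from a.a.s. `G(n,½)`; conjecturally
  the "super-Ramsey / non-supersaturated" graphs; attacked by the box-DAG lines, not by this one).
* `composition` : stub 1 → stub 2 → stub 3 → crux (unfolded form; kernel-checked, no `sorry`), and
  `ResolutionUncertainty_of` : the crux BY NAME from the three registered `stub_*` theorems.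

Honours the standing disprover's obstructions (Disproof.lean evidence notes of
refuter-cdisprove-stmt-PneNP-9816-0): both `K_k`-freeness of `G` and of `Gᶜ` are used (the case
split runs the engine on whichever side is rich and the residual stub keeps BOTH refutations);
the exponent is `min ε₂ ε₃`, never claimed above the `ε ≤ 1/2` boundary (`exists_ramsey_cheap`).
-/

set_option linter.dupNamespace false
set_option linter.unusedVariables false

namespace Summit.PneNP.PneNP.Cruxes.ResolutionUncertainty.JuknaGameMonotoneInterpolation

open scoped Classical
open Literature.Computability.Complexity Literature.Computability.MetaComplexity
open Summit.PneNP.PneNP.Theorems.RegularResolutionRung.Negative (cliqueCNF)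

/-! ## The crux, unfolded -/

/- `cliqueCNF n k adj` — the crux's inline unary block clique CNF as a NAMED tree declaration — is
REUSED from the sibling crux's landed support file
`Theorems/RegularResolutionRung/Negative/EmptyGraphLines.lean` (same text as the route's `let cnf`;
it also provides `isResDerivation_map_range`, useful for stub 1). -/

/-- The route's crux decl is definitionally the `cliqueCNF` statement (the `let`s unfolded). -/
theorem crux_unfold :
    Summit.PneNP.PneNP.Theses.RamseyUncertifiable.ResolutionUncertainty ↔
      ∃ ε : ℝ, 0 < ε ∧ ∃ n₀ : ℕ, ∀ n ≥ n₀, ∀ (G : SimpleGraph (Fin n)) [DecidableRel G.Adj],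
        ∀ π₁ π₂ : List (ResLine ℕ),
          IsResRefutation (cliqueCNF n (Nat.clog 2 (n ^ 2)) fun u v => decide (G.Adj u v)) π₁ →
          IsResRefutation (cliqueCNF n (Nat.clog 2 (n ^ 2)) fun u v => decide (Gᶜ.Adj u v)) π₂ →
          (n : ℝ) ^ (ε * Real.logb 2 n) ≤ max (π₁.length : ℝ) (π₂.length : ℝ) :=
  Iff.rfl

/-! ## Test inputs of the vertex-model separation problem -/

variable {n : ℕ}

/-- Positive test input: the indicator vector of a vertex set `x` (an Alice `kA`-clique). -/
def posVec (x : Finset (Fin n)) : Fin n → Bool := fun v => decide (v ∈ x)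

/-- Negative test input: the SHADOW of a Bob clique `y` on Alice's region `A`, i.e. the indicator
of `A ∩ N(y)` (`N(y)` = common neighbourhood; it excludes `y` itself). -/
def shadowVec (H : SimpleGraph (Fin n)) [DecidableRel H.Adj] (A y : Finset (Fin n)) :
    Fin n → Bool :=
  fun v => decide (v ∈ A ∧ ∀ w ∈ y, H.Adj v w)

/-- Common neighbourhood of `S` inside the region `T`. -/
def cnbIn (H : SimpleGraph (Fin n)) [DecidableRel H.Adj] (T S : Finset (Fin n)) : Finset (Fin n) :=
  T.filter fun v => ∀ w ∈ S, H.Adj v w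

/-- Alice's rich positives: `kA`-cliques `x ⊆ A` that extend to a clique `x ∪ S` by some
`j`-clique `S ⊆ B` (non-extendable cliques are separated from all shadows by the size-`n²` CNF
`⋀_{w ∈ B} ⋁_{v ∈ A, v ≁ w} z_v`, so only extendable ones can carry a lower bound). -/
noncomputable def extCliques (H : SimpleGraph (Fin n)) [DecidableRel H.Adj] (A B : Finset (Fin n))
    (kA j : ℕ) : Finset (Finset (Fin n)) :=
  A.powerset.filter fun x => H.IsNClique kA x ∧
    ∃ S ∈ B.powerset, H.IsNClique j S ∧ ∀ v ∈ x, ∀ w ∈ S, H.Adj v w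

/-- **Rich block split** of `H` with parameters `η, c` (write `L = log₂ n`): disjoint Alice/Bob
regions `A, B`, each of LINEAR size `≥ n/4` (vertices outside `A ∪ B` are ignored — up to `n/2`
junk vertices do not matter; linear size keeps `kA ≤ 2 log₂ |A|`, so that Alice's cliques are
the generic ones and cannot be confined to a planted corner of a `K_{kA}`-free bulk); block
sizes `kA + kB = ⌈log₂ n²⌉` with `c·L ≤ kB ≤ (1-η)L/2`; (`regular`) two-sided common-neighbourhood
regularity into `A` and into `B` for every `S ⊆ A ∪ B` with `|S| ≤ (1-2η)L` — relative error
`(1 ± 1/L)^{|S|}` around `|A|·2^{-|S|}`, `|B|·2^{-|S|}` (so all these common neighbourhoods have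
size `≥ n^{2η}/(4e)`, Bob `kB`-cliques exist greedily, and shadows obey a pseudo-product law up
to level `(1-3η)L/2`); (`many`) at least `n^{cL}` Alice `kA`-cliques of `A` extendable into `B`
by a `⌈cL⌉`-clique; (`spread`) these form an `n^{c}`-spread family. Holds a.a.s. for `G(n,½)`
(plus `≤ n/2` junk vertices) with `A, B` the two halves of the good part and `kB = ⌈4cL⌉`,
whenever `4c ≤ (1-η)/2` (clique counts `n^{(3c-4.5c²)L} ≥ n^{cL}`; codegree deviations
`O(L·n^{-η})`, far inside `1/L`). -/
structure RichSplit (η c : ℝ) (n : ℕ) (H : SimpleGraph (Fin n)) [DecidableRel H.Adj]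
    (A B : Finset (Fin n)) (kA kB : ℕ) : Prop where
  disjoint : Disjoint A B
  blocks : kA + kB = Nat.clog 2 (n ^ 2)
  kB_lower : c * Real.logb 2 n ≤ kB
  kB_upper : (kB : ℝ) ≤ (1 - η) / 2 * Real.logb 2 n
  cardA : (n : ℝ) / 4 ≤ A.card
  cardB : (n : ℝ) / 4 ≤ B.card
  regular : ∀ S : Finset (Fin n), S ⊆ A ∪ B → (S.card : ℝ) ≤ (1 - 2 * η) * Real.logb 2 n →
    (1 - 1 / Real.logb 2 n) ^ S.card * (A.card / 2 ^ S.card : ℝ) ≤ (cnbIn H A S).card ∧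
    ((cnbIn H A S).card : ℝ) ≤ (1 + 1 / Real.logb 2 n) ^ S.card * (A.card / 2 ^ S.card : ℝ) ∧
    (1 - 1 / Real.logb 2 n) ^ S.card * (B.card / 2 ^ S.card : ℝ) ≤ (cnbIn H B S).card ∧
    ((cnbIn H B S).card : ℝ) ≤ (1 + 1 / Real.logb 2 n) ^ S.card * (B.card / 2 ^ S.card : ℝ)
  many : (n : ℝ) ^ (c * Real.logb 2 n) ≤ (extCliques H A B kA ⌈c * Real.logb 2 n⌉₊).card
  spread : ∀ S : Finset (Fin n), S ⊆ A → S.Nonempty →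
    (((extCliques H A B kA ⌈c * Real.logb 2 n⌉₊).filter fun x => S ⊆ x).card : ℝ) *
        (n : ℝ) ^ (c * S.card) ≤ (extCliques H A B kA ⌈c * Real.logb 2 n⌉₊).card

/-! ## Stub statements (named; the registered stubs below assert them) -/

/-- **Stub 1 — block-bipartition interpolation** (Krajíček 1997 / Karchmer–Wigderson; the SIZE
form of Jukna's clique game, arXiv:1203.5414 Thm 2; GGKS rect-DAG ≤ refutation). Split the
`k = kA + kB` blocks of `Clique(H,k)`: Alice owns blocks `< kA`, Bob the rest (and every junk
variable). Reading `π` gate by gate — Alice-pivot ↦ `∨`, Bob-pivot ↦ `∧`, weakening ↦ same wire,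
pure-Alice axiom ↦ `0`, pure-Bob axiom ↦ `1`, cross edge axiom `¬x_{i,u} ∨ ¬x_{j,w}` ↦ input `z_u`
(`u` the Alice vertex) — gives a circuit over `{∧₂, ∨₂, 0, 1}` with at most one gate per line that
accepts `1_x` for every `kA`-clique `x` and rejects `1_{A ∩ N(y)}` for every `kB`-clique `y`
(invariant: gate of clause `D` accepts all Alice cliques falsifying `D`'s Alice part, rejects the
shadows of all Bob cliques falsifying its Bob part). Provable now; no restriction, no width. -/
def BlockInterpolation : Prop :=
  ∀ (n : ℕ) (H : SimpleGraph (Fin n)) [DecidableRel H.Adj] (A : Finset (Fin n)) (kA kB : ℕ),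
    kA + kB = Nat.clog 2 (n ^ 2) →
    ∀ π : List (ResLine ℕ),
      IsResRefutation (cliqueCNF n (Nat.clog 2 (n ^ 2)) fun u v => decide (H.Adj u v)) π →
      ∃ C : Circuit (Fin n), C.IsOver monotoneBasis01 ∧ C.size ≤ π.length ∧
        (∀ x : Finset (Fin n), H.IsNClique kA x → C.eval (posVec x) = true) ∧
        (∀ y : Finset (Fin n), H.IsNClique kB y → C.eval (shadowVec H A y) = false)

/-- **Stub 1a — generic monotone straight-line extraction** (the circuit plumbing behind
Krajíček 1997 / Karchmer–Wigderson interpolation for resolution). Given any line sequence `π`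
whose premise indices point backwards, a classification `isOr` of pivot variables (Alice pivot ↦
`∨`, Bob pivot ↦ `∧`) and a leaf labelling of initial lines by an input variable or a constant,
there is a circuit over `{∧₂, ∨₂, 0, 1}` with at most one gate per line whose value at the chosen
output line `r` is the function `val r` defined by the evident recursion along `π` (initial ↦ leaf,
resolve ↦ `∨`/`∧` of the premises' values, weaken ↦ the premise's value). Construction: gate `t` is
`or₂(w, w)` for an input leaf / a weakening (wire `w` of the leaf / premise), `const b` for a constant
leaf, `or₂`/`and₂` of the premise gates for a resolution line; `Circuit.wf` from the backward
premise indices; `val t z := (vals gates z)[t]`. Provable now, size M (tree `GateList.vals`,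
`vals_append_singleton`, `getD_vals_append_cons`, `WF.append_singleton`, `toCircuit`). -/
def MonotoneExtraction : Prop :=
  ∀ (ι : Type) (π : List (ResLine ℕ)) (isOr : ℕ → Bool) (leaf : ℕ → ι ⊕ Bool) (r : ℕ),
    r < π.length →
    (∀ t (ht : t < π.length), ∀ i ∈ (π[t]'ht).premises, i < t) →
    ∃ (C : Circuit ι) (val : ℕ → (ι → Bool) → Bool),
      C.IsOver monotoneBasis01 ∧ C.size ≤ π.length ∧ (∀ z, C.eval z = val r z) ∧
      ∀ t (ht : t < π.length) (z : ι → Bool),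
        val t z =
          (match (π[t]'ht).rule with
            | .initial => Sum.elim z id (leaf t)
            | .resolve i j v => if isOr v then (val i z || val j z) else (val i z && val j z)
            | .weaken i => val i z)

/-- **Stub 2 — shadow lower bound (the engine; research).** For every rich block split (all
parameters `0 < η, c ≤ 1/8`), every monotone circuit over the vertex variables that accepts the
`kA`-cliques of `A` and rejects the shadows `A ∩ N(y)` of the `kB`-cliques of `B` has size
`≥ n^{ε log₂ n}`, `ε = ε(η,c) > 0`. A monotone SIZE lower bound for Jukna's induced-clique
function `ICLIQUE_{H[A],kA}` on the promise set {cliques} ∪ {shadows} (Jukna 2012 §5 asks for it);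
intended engine: Razborov / Alon–Boppana / Cavalar–Kumar–Rossman approximation in the vertex
model with `ℓ = Θ(log n)`-set approximators. Known obstruction (line card): shadows are
intersections of catalogue half-spaces `N(v)`, so per-plucking error is only `n^{-O(1)}` and the
robust-sunflower union bound does not transfer verbatim — a global error accounting is needed.
Consistent with the cheap separators: CNF over `kB`-cliques (`n^{kB}`), `f_j` (`n^{j+1}`) ⇒
`ε ≤ min(c, kB/L)`. -/
def ShadowLowerBound : Prop :=
  ∀ η c : ℝ, 0 < η → η ≤ 1 / 8 → 0 < c → c ≤ 1 / 8 →
    ∃ ε : ℝ, 0 < ε ∧ ∃ n₀ : ℕ, ∀ n ≥ n₀, ∀ (H : SimpleGraph (Fin n)) [DecidableRel H.Adj]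
      (A B : Finset (Fin n)) (kA kB : ℕ), RichSplit η c n H A B kA kB →
      ∀ C : Circuit (Fin n), C.IsOver monotoneBasis01 →
        (∀ x : Finset (Fin n), x ⊆ A → H.IsNClique kA x → C.eval (posVec x) = true) →
        (∀ y : Finset (Fin n), y ⊆ B → H.IsNClique kB y → C.eval (shadowVec H A y) = false) →
        (n : ℝ) ^ (ε * Real.logb 2 n) ≤ C.size

/-- **Stub 3 — structured residual (delegated, not attacked by this line).** For SOME admissible
parameters `η, c`, the crux's conclusion holds for the graphs NEITHER of whose sides `G`, `Gᶜ`
admits a rich block split. This class excludes a.a.s. `G(n,½)` (rich on both sides, also with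
up to `n/2` junk vertices added) and every 2-Ramsey graph that is random-like at logarithmic
scale on an induced bipartite block of linear size; conjecturally it consists of "super-Ramsey"
graphs (`max(ω,α) < (1+γ)log₂ n`; existence for large `n` ⇔ `R(s,s) ≥ 2^{s/(1+γ)}`, open) and
non-supersaturated near-extremal graphs — for all of which NOTHING beyond brute force
`n^{max(ω,α)+O(1)}` (Disproof.lean `exists_refutation_le_pow_cliqueNum`) is known either way.
It is implied by the crux, vacuous off 2-Ramsey graphs, and is the natural target of the
Prömel–Rödl-core (box-DAG) lines; recommended to tenure as a first-class split of the item. -/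
def StructuredResidual : Prop :=
  ∃ η c : ℝ, 0 < η ∧ η ≤ 1 / 8 ∧ 0 < c ∧ c ≤ 1 / 8 ∧
  ∃ ε : ℝ, 0 < ε ∧ ∃ n₀ : ℕ, ∀ n ≥ n₀, ∀ (G : SimpleGraph (Fin n)) [DecidableRel G.Adj],
    (¬ ∃ (A B : Finset (Fin n)) (kA kB : ℕ), RichSplit η c n G A B kA kB) →
    (¬ ∃ (A B : Finset (Fin n)) (kA kB : ℕ), RichSplit η c n Gᶜ A B kA kB) →
    ∀ π₁ π₂ : List (ResLine ℕ),
      IsResRefutation (cliqueCNF n (Nat.clog 2 (n ^ 2)) fun u v => decide (G.Adj u v)) π₁ →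
      IsResRefutation (cliqueCNF n (Nat.clog 2 (n ^ 2)) fun u v => decide (Gᶜ.Adj u v)) π₂ →
      (n : ℝ) ^ (ε * Real.logb 2 n) ≤ max (π₁.length : ℝ) (π₂.length : ℝ)

/-! ## Registered stubs -/

/-- **Registered stub 1a — monotone extraction** (`MonotoneExtraction`, stated inline; provable
now, size M; worker target `Theorems/RamseyUncertifiableResolutionUncertaintyMonotoneExtraction.lean`). -/
theorem stub_monotoneExtraction :
    ∀ (ι : Type) (π : List (ResLine ℕ)) (isOr : ℕ → Bool) (leaf : ℕ → ι ⊕ Bool) (r : ℕ),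
      r < π.length →
      (∀ t (ht : t < π.length), ∀ i ∈ (π[t]'ht).premises, i < t) →
      ∃ (C : Circuit ι) (val : ℕ → (ι → Bool) → Bool),
        C.IsOver monotoneBasis01 ∧ C.size ≤ π.length ∧ (∀ z, C.eval z = val r z) ∧
        ∀ t (ht : t < π.length) (z : ι → Bool),
          val t z =
            (match (π[t]'ht).rule with
              | .initial => Sum.elim z id (leaf t)
              | .resolve i j v => if isOr v then (val i z || val j z) else (val i z && val j z)
              | .weaken i => val i z) := by
  sorry

/-- **Registered stub 1b — the block-split invariant** (`MonotoneExtraction → BlockInterpolation`,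
stated inline with `posVec`/`shadowVec` unfolded; provable now, size M; worker target
`Theorems/RamseyUncertifiableResolutionUncertaintyBlockInterpolation.lean`). Instantiate 1a with
`ι := Fin n`, `isOr w := decide (w / n < kA)` (Alice owns blocks `< kA`; Bob owns the rest and every
junk variable `≥ k·n`), `r :=` the index of an empty clause, and the leaf labelling of an initial
clause `D`: all variables Alice ↦ constant `false`; all variables Bob ↦ constant `true`; otherwise
(`D` is a cross edge axiom `¬x_{i,u} ∨ ¬x_{j,w}` with exactly one Alice literal, `adj u w = false`) ↦
the input `z_u` of its Alice vertex. INVARIANT at line `t` with clause `D` (strong induction on `t`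
using the recursion equations of 1a; premise indices `< t` from `IsResDerivation`): (P) for every
injective `α : Fin kA → Fin n` onto a clique that falsifies every Alice literal of `D` (literal
`(i·n+u, b)` with `i < kA` is falsified iff `(α i = u) ≠ b`), `val t (indicator of range α) = true`;
(N) for every injective `β : Fin kB → Fin n` onto a clique that falsifies every Bob literal of `D`
(block `kA + j` read through `β j`; junk variables read `false`), `val t (shadow of range β) = false`.
Leaves by `cliqueCNF_cases` (a clique assignment falsifies no pure axiom of its own side; a cross
axiom's input `z_u` is `1` on cliques through `u` and `0` on shadows of cliques through `w ≁ u`);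
`∨` step: `α` falsifies the erased pivot literal of one premise; `∧` step dually; weakening: subset.
At the empty clause every `kA`-clique `x` (`α := x.orderEmbOfFin`) is accepted and every shadow of a
`kB`-clique is rejected. No soundness, no restriction, no width. -/
theorem stub_blockInvariant :
    (∀ (ι : Type) (π : List (ResLine ℕ)) (isOr : ℕ → Bool) (leaf : ℕ → ι ⊕ Bool) (r : ℕ),
      r < π.length →
      (∀ t (ht : t < π.length), ∀ i ∈ (π[t]'ht).premises, i < t) →
      ∃ (C : Circuit ι) (val : ℕ → (ι → Bool) → Bool),
        C.IsOver monotoneBasis01 ∧ C.size ≤ π.length ∧ (∀ z, C.eval z = val r z) ∧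
        ∀ t (ht : t < π.length) (z : ι → Bool),
          val t z =
            (match (π[t]'ht).rule with
              | .initial => Sum.elim z id (leaf t)
              | .resolve i j v => if isOr v then (val i z || val j z) else (val i z && val j z)
              | .weaken i => val i z)) →
    ∀ (n : ℕ) (H : SimpleGraph (Fin n)) [DecidableRel H.Adj] (A : Finset (Fin n)) (kA kB : ℕ),
      kA + kB = Nat.clog 2 (n ^ 2) →
      ∀ π : List (ResLine ℕ),
        IsResRefutation (cliqueCNF n (Nat.clog 2 (n ^ 2)) fun u v => decide (H.Adj u v)) π →
        ∃ C : Circuit (Fin n), C.IsOver monotoneBasis01 ∧ C.size ≤ π.length ∧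
          (∀ x : Finset (Fin n), H.IsNClique kA x → C.eval (fun v => decide (v ∈ x)) = true) ∧
          (∀ y : Finset (Fin n), H.IsNClique kB y →
            C.eval (fun v => decide (v ∈ A ∧ ∀ w ∈ y, H.Adj v w)) = false) := by
  sorry

/-- Read-back: the two registered stubs 1a, 1b prove the named statements. -/
theorem monotoneExtraction_of_stub : MonotoneExtraction := stub_monotoneExtraction

/-- Read-back: `BlockInterpolation` (with `posVec`, `shadowVec` by definitional unfolding). -/
theorem blockInterpolation_of_stubs : BlockInterpolation :=
  fun n H _ A kA kB hk π hπ => stub_blockInvariant stub_monotoneExtraction n H A kA kB hk π hπ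

/-- Registered stub 2 (the engine; hardest stub of the line). -/
theorem stub_shadowLowerBound : ShadowLowerBound := by
  sorry

/-- Registered stub 3 (structured residual; delegated). -/
theorem stub_structuredResidual : StructuredResidual := by
  sorry

/-! ## Composition (kernel-checked, no sorry) -/

/-- One rich side suffices: interpolation + shadow lower bound bound ONE refutation from below. -/
theorem length_ge_of_richSplit (hI : BlockInterpolation) {η c ε : ℝ} {n : ℕ}
    (hE : ∀ (H : SimpleGraph (Fin n)) [DecidableRel H.Adj] (A B : Finset (Fin n)) (kA kB : ℕ),
      RichSplit η c n H A B kA kB →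
      ∀ C : Circuit (Fin n), C.IsOver monotoneBasis01 →
        (∀ x : Finset (Fin n), x ⊆ A → H.IsNClique kA x → C.eval (posVec x) = true) →
        (∀ y : Finset (Fin n), y ⊆ B → H.IsNClique kB y → C.eval (shadowVec H A y) = false) →
        (n : ℝ) ^ (ε * Real.logb 2 n) ≤ C.size)
    (H : SimpleGraph (Fin n)) [DecidableRel H.Adj] {A B : Finset (Fin n)} {kA kB : ℕ}
    (hR : RichSplit η c n H A B kA kB) {π : List (ResLine ℕ)}
    (hπ : IsResRefutation (cliqueCNF n (Nat.clog 2 (n ^ 2)) fun u v => decide (H.Adj u v)) π) :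
    (n : ℝ) ^ (ε * Real.logb 2 n) ≤ (π.length : ℝ) := by
  obtain ⟨C, hmono, hsize, hpos, hneg⟩ := hI n H A kA kB hR.blocks π hπ
  have h := hE H A B kA kB hR C hmono (fun x _ hx => hpos x hx) (fun y _ hy => hneg y hy)
  exact h.trans (by exact_mod_cast hsize)

/-- **Composition** `stub 1 → stub 2 → stub 3 → crux` (the crux in its unfolded `cliqueCNF` form,
`crux_unfold`). Structure/randomness split: if `G` or `Gᶜ` has a rich block split, stubs 1 and 2
bound the corresponding refutation; otherwise stub 3 applies. Exponent `min ε₂ ε₃`. -/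
theorem composition (hI : BlockInterpolation) (hE : ShadowLowerBound) (hS : StructuredResidual) :
    ∃ ε : ℝ, 0 < ε ∧ ∃ n₀ : ℕ, ∀ n ≥ n₀, ∀ (G : SimpleGraph (Fin n)) [DecidableRel G.Adj],
      ∀ π₁ π₂ : List (ResLine ℕ),
        IsResRefutation (cliqueCNF n (Nat.clog 2 (n ^ 2)) fun u v => decide (G.Adj u v)) π₁ →
        IsResRefutation (cliqueCNF n (Nat.clog 2 (n ^ 2)) fun u v => decide (Gᶜ.Adj u v)) π₂ →
        (n : ℝ) ^ (ε * Real.logb 2 n) ≤ max (π₁.length : ℝ) (π₂.length : ℝ) := by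
  obtain ⟨η, c, hη, hη', hc, hc', ε₃, hε₃, n₃, h₃⟩ := hS
  obtain ⟨ε₂, hε₂, n₂, h₂⟩ := hE η c hη hη' hc hc'
  refine ⟨min ε₂ ε₃, lt_min hε₂ hε₃, max (max n₂ n₃) 1, fun n hn G _ π₁ π₂ hπ₁ hπ₂ => ?_⟩
  have hn₂ : n₂ ≤ n := le_trans (le_trans (le_max_left _ _) (le_max_left _ _)) hn
  have hn₃ : n₃ ≤ n := le_trans (le_trans (le_max_right _ _) (le_max_left _ _)) hn
  have hn1 : (1 : ℝ) ≤ n := by exact_mod_cast le_trans (le_max_right _ _) hn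
  have hL : 0 ≤ Real.logb 2 (n : ℝ) := Real.logb_nonneg one_lt_two hn1
  have hmono : ∀ {ε : ℝ}, min ε₂ ε₃ ≤ ε →
      (n : ℝ) ^ (min ε₂ ε₃ * Real.logb 2 n) ≤ (n : ℝ) ^ (ε * Real.logb 2 n) := fun hε =>
    Real.rpow_le_rpow_of_exponent_le hn1 (mul_le_mul_of_nonneg_right hε hL)
  by_cases hG : ∃ (A B : Finset (Fin n)) (kA kB : ℕ), RichSplit η c n G A B kA kB
  · obtain ⟨A, B, kA, kB, hR⟩ := hG
    have h := length_ge_of_richSplit hI (h₂ n hn₂) G hR hπ₁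
    exact ((hmono (min_le_left _ _)).trans h).trans (le_max_left _ _)
  · by_cases hG' : ∃ (A B : Finset (Fin n)) (kA kB : ℕ), RichSplit η c n Gᶜ A B kA kB
    · obtain ⟨A, B, kA, kB, hR⟩ := hG'
      have h := length_ge_of_richSplit hI (h₂ n hn₂) Gᶜ hR hπ₂
      exact ((hmono (min_le_left _ _)).trans h).trans (le_max_right _ _)
    · exact (hmono (min_le_right _ _)).trans (h₃ n hn₃ G hG hG' π₁ π₂ hπ₁ hπ₂)

/-- **The skeleton.** The crux BY NAME from the four registered stubs (sorries live only in
`stub_monotoneExtraction`, `stub_blockInvariant`, `stub_shadowLowerBound`, `stub_structuredResidual`). -/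
theorem ResolutionUncertainty_of :
    Summit.PneNP.PneNP.Theses.RamseyUncertifiable.ResolutionUncertainty :=
  crux_unfold.mpr (composition blockInterpolation_of_stubs stub_shadowLowerBound stub_structuredResidual)

end Summit.PneNP.PneNP.Cruxes.ResolutionUncertainty.JuknaGameMonotoneInterpolation
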